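import Mathlib
import Summits.PneNP.PneNP.Theorems.LatticeMagicTargetDefs
import Literature.Computability.Complexity.CNF
import Literature.Computability.MetaComplexity.ProofSystems
import Literature.Computability.Complexity.ListFoldBricks
import Literature.Computability.Complexity.StringCopy
import Literature.Computability.MetaComplexity.EFScaffold
import HarnessLib

/-!
# Route LatticeMagic, crux `Target` (stmt-PneNP-10709) — line `SketchIdeator5`: apex B is void if `TAUT ∈ P`

Strength certificate for apex B of the line (`Cruxes/Target/Lines/SketchIdeator5.lean`): apex B is
"for every Cook–Reckhow proof system `V` for `TAUT`, `STHyp V → NP ≠ coNP`" (Krajíček,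
arXiv:2506.20221, Thm 4.1 with the MEP folded in). This file shows that its hypothesis `STHyp V`
("the search problem `DD_V` is not solved by a p-time student in `O(1)` rounds",
`LatticeMagicTargetDefs.lean` §2) is refuted by `TAUT ∈ P` — in particular by `P = NP` — for EVERY
proof system `V` for `TAUT`: a polynomial-time student then wins `DD_V` in ONE round on every
instance, against every teacher (`stHyp_false_of_TAUT_mem_P`).

* §1 Logic: the semantics of `bigDisj` (`eval_bigDisj`) and the disjointness lemma — a tautological
  disjunction of pairwise variable-disjoint formulas has a tautological disjunct
  (`exists_isTautology_of_bigDisj`; falsifying assignments of variable-disjoint formulas merge,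
  `PropForm.eval_congr_vars`).
* §2 The one-round student as a pipeline of the tree's `FP` bricks (`exists_student`): the
  `TAUT`-indicator brick (`indicatorFn_mem_FP`) folded over the coded list of disjuncts
  (`Brick.foldFn`, `ListFoldBricks.lean`) with a "found" flag and a unary counter, so that the output
  has length = the index of the first tautological disjunct (the answer is read in unary,
  `unaryDecodeNat = length`). The step is a term of the proof: the file adds no definitions.
* §3 The certificate `stHyp_false_of_TAUT_mem_P`.
-/

set_option linter.dupNamespace false -- `Summit.PneNP.PneNP.…`: summit = sub-problem (D-0017)

namespace Summit.PneNP.PneNP.Theorems.LatticeMagicTarget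

open Literature.Computability.Complexity Literature.Computability.MetaComplexity
open _root_.Computability

namespace SqueezeVacuity

/-! ### 1. A tautological disjoint disjunction has a tautological disjunct -/

/-- Semantics of `bigDisj`: `⋁ l` is true under `σ` iff some member of `l` is. -/
theorem eval_bigDisj (σ : ℕ → Bool) :
    ∀ l : List (PropForm ℕ), (bigDisj l).eval σ = true ↔ ∃ φ ∈ l, φ.eval σ = true
  | [] => by simp [bigDisj, PropForm.eval]
  | [φ] => by simp [bigDisj]
  | φ :: ψ :: l => by
    rw [show bigDisj (φ :: ψ :: l) = .disj φ (bigDisj (ψ :: l)) from rfl]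
    simp only [PropForm.eval, Bool.or_eq_true, eval_bigDisj σ (ψ :: l)]
    constructor
    · rintro (h | ⟨χ, hχ, h⟩)
      · exact ⟨φ, List.mem_cons_self, h⟩
      · exact ⟨χ, List.mem_cons_of_mem φ hχ, h⟩
    · rintro ⟨χ, hχ, h⟩
      rcases List.mem_cons.1 hχ with rfl | hχ
      · exact Or.inl h
      · exact Or.inr ⟨χ, hχ, h⟩

/-- Pairwise variable-disjoint non-tautologies are falsified by ONE common assignment (merge the
individual falsifying assignments along the disjoint variable sets). -/
theorem exists_eval_eq_false {l : List (PropForm ℕ)}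
    (hd : l.Pairwise fun φ ψ => Disjoint φ.vars ψ.vars) (h : ∀ φ ∈ l, ¬ φ.IsTautology) :
    ∃ σ : ℕ → Bool, ∀ φ ∈ l, φ.eval σ = false := by
  induction l with
  | nil => exact ⟨fun _ => false, fun φ hφ => absurd hφ List.not_mem_nil⟩
  | cons φ l ih =>
    rw [List.pairwise_cons] at hd
    obtain ⟨σ', hσ'⟩ := ih hd.2 fun ψ hψ => h ψ (List.mem_cons_of_mem φ hψ)
    obtain ⟨σ₀, hσ₀⟩ : ∃ σ₀ : ℕ → Bool, φ.eval σ₀ = false := by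
      have hφ := h φ List.mem_cons_self
      simp only [PropForm.IsTautology, not_forall, Bool.not_eq_true] at hφ
      exact hφ
    refine ⟨fun x => if x ∈ φ.vars then σ₀ x else σ' x, fun ψ hψ => ?_⟩
    rcases List.mem_cons.1 hψ with rfl | hψ
    · rw [← hσ₀]
      exact PropForm.eval_congr_vars fun v hv => if_pos hv
    · rw [← hσ' ψ hψ]
      exact PropForm.eval_congr_vars fun v hv =>
        if_neg fun hv' => Finset.disjoint_left.1 (hd.1 ψ hψ) hv' hv

/-- **A tautological disjunction of pairwise variable-disjoint formulas has a tautological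
disjunct** (the logical content of the totality of Krajíček's search problem `DD_V`). Note
`bigDisj [] = ⊥` is not a tautology, so the disjunct found is a genuine member. -/
theorem exists_isTautology_of_bigDisj {l : List (PropForm ℕ)}
    (hd : l.Pairwise fun φ ψ => Disjoint φ.vars ψ.vars) (ht : (bigDisj l).IsTautology) :
    ∃ φ ∈ l, φ.IsTautology := by
  by_contra h
  push Not at h
  obtain ⟨σ, hσ⟩ := exists_eval_eq_false hd h
  obtain ⟨φ, hφ, hφσ⟩ := (eval_bigDisj σ l).1 (ht σ)
  rw [hσ φ hφ] at hφσ
  exact Bool.false_ne_true hφσ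

/-! ### 2. The one-round student: first tautological disjunct, by a fold of `FP` bricks -/

section Student

open Brick

/-- On a code `encode φ` the `TAUT`-indicator reads off tautologyhood (`mem_TAUT_iff`). -/
theorem boolIndicator_TAUT_encode (φ : PropForm ℕ) :
    TAUT.boolIndicator (encodingPropForm.encode φ) = true ↔ φ.IsTautology :=
  (Set.mem_iff_boolIndicator TAUT _).symm.trans (mem_TAUT_iff φ)

/-- The line's `flat` is the tree's list coding `encList`. -/
theorem flat_eq_encList : ∀ l : List (List Bool), flat l = encList l
  | [] => rfl
  | a :: l => by rw [flat, encList_cons, flat_eq_encList l]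

/-- **The one-round student.** If `TAUT ∈ P` there is a polynomial-time `S` whose value on the
initial view `⟨⟨π, L⟩, ε⟩` of every `DD_V`-instance (for every `V`) has length the index of the first
disjunct whose code is in `TAUT`: `S = sndF ∘ foldFn step (· ↦ ⟨ε, ε⟩) ∘ fstF` folds a step brick
over the coded list `L` of disjuncts (`Brick.foldFn_mem_FP`, growth constant `4`) and outputs the
unary counter. The step, on step arguments `⟨u, ⟨a, ⟨flag, cnt⟩⟩⟩`: while the flag is empty, test the
item `a` with the `TAUT`-indicator brick (`indicatorFn_mem_FP`) — in `TAUT`: set the flag to `[1]`;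
not in `TAUT`: bump the unary counter `cnt` —; once the flag is set, freeze the accumulator. -/
theorem exists_student (hT : TAUT ∈ Classes.P) :
    ∃ S : List Bool → List Bool, S ∈ FP ∧ ∀ (V : List Bool → List Bool → Bool) (I : DDInstance V),
      (S (ddView I [])).length = (I.l.map encodingPropForm.encode).findIdx TAUT.boolIndicator := by
  have hind : (fun w : List Bool => [TAUT.boolIndicator w]) ∈ FP := indicatorFn_mem_FP hT
  have h1 : OneBit (fun w : List Bool => [TAUT.boolIndicator w]) := fun _ => ⟨_, rfl⟩
  -- the fold step (a term of the proof, so that the file adds no definition to the tree)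
  obtain ⟨step, hstep⟩ : ∃ step : List Bool → List Bool, step =
      iteFn (isNilFn ∘ fstF ∘ sndPow 1)
        (iteFn ((fun w : List Bool => [TAUT.boolIndicator w]) ∘ nthF 1)
          (fanoutFn (fun _ => [true]) (sndF ∘ sndPow 1))
          (fanoutFn (fun _ => ([] : List Bool)) (List.cons true ∘ sndF ∘ sndPow 1)))
        (sndPow 1) := ⟨_, rfl⟩
  -- the step is polynomial-time
  have hFP : step ∈ FP := by
    rw [hstep]
    exact iteFn_mem_FP (comp_mem_FP isNilFn_mem_FP (comp_mem_FP fstF_mem_FP (sndPow_mem_FP 1)))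
      (iteFn_mem_FP (comp_mem_FP hind (nthF_mem_FP 1))
        (fanoutFn_mem_FP (const_mem_FP _) (comp_mem_FP sndF_mem_FP (sndPow_mem_FP 1)))
        (fanoutFn_mem_FP (const_mem_FP _)
          (comp_mem_FP (cons_mem_FP true) (comp_mem_FP sndF_mem_FP (sndPow_mem_FP 1)))))
      (sndPow_mem_FP 1)
  -- the step has growth constant `4` (on every input the new accumulator is at most 4 longer)
  have hgrowth : FoldGrowth 4 step := by
    intro v
    have hacc := length_fstF_sndF_le (sndF (sndF v))
    rw [hstep, iteFn_of_oneBit (oneBit_isNilFn.comp _)]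
    split_ifs
    · rw [iteFn_of_oneBit (h1.comp _)]
      split_ifs
      · rw [fanoutFn_apply, length_boolPair]
        simp only [Function.comp_apply, sndPow, List.length_cons, List.length_nil]
        omega
      · rw [fanoutFn_apply, length_boolPair]
        simp only [Function.comp_apply, sndPow, List.length_cons, List.length_nil]
        omega
    · simp only [sndPow, Function.comp_apply]
      omega
  -- values of the step: a frozen accumulator stays, a live one tests the item
  have hfound : ∀ u a cnt : List Bool,
      step (boolPair u (boolPair a (boolPair [true] cnt))) = boolPair [true] cnt := by
    intro u a cnt
    rw [hstep, iteFn_apply (b := false) (by simp [isNilFn, sndPow])]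
    simp [sndPow]
  have hlive : ∀ u a cnt : List Bool, step (boolPair u (boolPair a (boolPair [] cnt))) =
      if TAUT.boolIndicator a then boolPair [true] cnt else boolPair [] (true :: cnt) := by
    intro u a cnt
    rw [hstep, iteFn_apply (b := true) (by simp [isNilFn, sndPow]), if_pos rfl,
      iteFn_apply (b := TAUT.boolIndicator a) (by simp [nthF])]
    cases TAUT.boolIndicator a <;> simp [sndPow]
  -- semantics of the fold: from a frozen accumulator nothing changes; from a live one with counter
  -- `cnt` the final counter has length `|cnt| +` the index of the first item in `TAUT`
  have hfoldT : ∀ (x cnt : List Bool) (l : List (List Bool)),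
      l.foldl (fun acc a => step (boolPair x (boolPair a acc))) (boolPair [true] cnt) =
        boolPair [true] cnt := by
    intro x cnt l
    induction l with
    | nil => rfl
    | cons a l ih => rw [List.foldl_cons, hfound]; exact ih
  have hfoldN : ∀ (x : List Bool) (l : List (List Bool)) (cnt : List Bool),
      (sndF (l.foldl (fun acc a => step (boolPair x (boolPair a acc))) (boolPair [] cnt))).length =
        cnt.length + l.findIdx TAUT.boolIndicator := by
    intro x l
    induction l with
    | nil => intro cnt; simp
    | cons a l ih =>
      intro cnt
      rw [List.foldl_cons, hlive, List.findIdx_cons]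
      cases TAUT.boolIndicator a
      · rw [Bool.cond_false, if_neg Bool.false_ne_true, ih (true :: cnt), List.length_cons]
        omega
      · rw [Bool.cond_true, if_pos rfl, hfoldT, sndF_boolPair, Nat.add_zero]
  -- the student: fold over the list component of the instance, output the counter
  refine ⟨sndF ∘ foldFn step (fun _ => boolPair [] []) ∘ fstF,
    comp_mem_FP sndF_mem_FP (comp_mem_FP (foldFn_mem_FP hFP (const_mem_FP _) hgrowth) fstF_mem_FP),
    fun V I => ?_⟩
  simp only [Function.comp_apply, ddView, fstF_boolPair]
  rw [foldFn_boolPair, flat_eq_encList, decNil_encList, hfoldN, List.length_nil, Nat.zero_add]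

end Student

end SqueezeVacuity

open SqueezeVacuity in
/-- **Apex B is void under `TAUT ∈ P`.** If `TAUT ∈ P` (e.g. if `P = NP`) then NO proof system `V`
for `TAUT` has an ST-hard search problem `DD_V`: the polynomial-time student of `exists_student`
reads the disjuncts off the instance, tests each for membership in `TAUT`, and names the first
tautological one — which exists because `π : V ⊢ ⋁ l` makes `⋁ l` a tautology (soundness of `V`)
and the disjuncts are variable-disjoint (`exists_isTautology_of_bigDisj`) — so it wins in round `0`
against every teacher, contradicting `STHyp V` at `k = 1`. -/
theorem stHyp_false_of_TAUT_mem_P (V : List Bool → List Bool → Bool) (hV : IsProofSystemFor V TAUT)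
    (hT : TAUT ∈ Classes.P) : ¬ STHyp V := by
  intro h
  obtain ⟨S, hS, hSv⟩ := exists_student hT
  obtain ⟨I, T, -, hwin⟩ := h 1 S hS
  obtain ⟨φ, hφ, hφt⟩ := exists_isTautology_of_bigDisj I.disjoint
    ((mem_TAUT_iff _).1 (hV.mem_of_eq_true I.proves))
  have hex : ∃ a ∈ I.l.map encodingPropForm.encode, TAUT.boolIndicator a = true :=
    ⟨_, List.mem_map.2 ⟨φ, hφ, rfl⟩, (boolIndicator_TAUT_encode φ).2 hφt⟩
  have hlt := List.findIdx_lt_length_of_exists hex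
  have hc : TAUT.boolIndicator
      (I.l.map encodingPropForm.encode)[(I.l.map encodingPropForm.encode).findIdx TAUT.boolIndicator]
      = true := List.findIdx_getElem
  rw [List.getElem_map, boolIndicator_TAUT_encode] at hc
  rw [List.length_map] at hlt
  have hprop : ddProposal S T I 0 = (I.l.map encodingPropForm.encode).findIdx TAUT.boolIndicator :=
    hSv V I
  exact hwin ⟨0, Nat.zero_lt_one, I.l[(I.l.map encodingPropForm.encode).findIdx TAUT.boolIndicator],
    by rw [hprop]; exact List.getElem?_eq_getElem hlt, hc⟩

end Summit.PneNP.PneNP.Theorems.LatticeMagicTarget
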